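import Literature.NumberTheory.LFunctions.EulerFactorPartialFractions
import Literature.NumberTheory.LFunctions.RayClassXi
import HarnessLib

/-!
# Deuring–Heilbronn for congruence class groups, II: the node family of the Euler factors at the modulus

Topic `Literature/NumberTheory/LFunctions` (namespace `Literature.NumberTheory.LFunctions`).  Everything here is PROVED;
`eulerFamilyNode`, `eulerFamilyWt`, `eulerProd`, `RayClassPrimitiveData.eulerCorrConj`, `RayClassPrimitiveData.LModConj`
are definitions with bodies.

For a finite set `T` of primes of `K` and unimodular coefficients `c_𝔭` (`𝔭 ∈ T`), the finite Euler product
`E(s) = ∏_{𝔭 ∈ T} (1 − c_𝔭 N𝔭^{-s})` (`eulerProd`; for `T` = the primes dividing `𝔪` but not the conductor and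
`c_𝔭 = χ₀(𝔭)` this is the correction `L_𝔪(s,χ) = L(s,χ₀) E(s)` between the imprimitive and the primitive Hecke
`L`-function, Neukirch VII §8) has the purely imaginary zeros `ω_{𝔭,n} = i(arg c_𝔭 + 2πn)/log N𝔭`
(`eulerFamilyNode`, indexed by `(𝔭, n) ∈ primes × ℤ` with weight `1_{𝔭 ∈ T}`), and for `Re s > 0`, `k ≥ 1`:

* `hasSum_eulerFamily` — `Σ_{𝔭 ∈ T} Σ_{n ∈ ℤ} (s − ω_{𝔭,n})^{−(k+1)} = ((−1)^k/k!) (E'/E)^{(k)}(s)`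
  [cite: ThornerZaman2017, Lemma 2.2] (the trivial zeros of the Euler factors in the explicit formula);
* `tsum_eulerFamilyWt_mul_norm_le` — `Σ_{𝔭 ∈ T} Σ_n |s − ω_{𝔭,n}|^{−2} ≤ Σ_{𝔭 ∈ T} (2/σ² + log N𝔭/σ)`
  [cite: ThornerZaman2017, Lemma 7.3].

We also record the conjugate Euler correction `Ē(s) = ∏(1 − χ̄₀(𝔭) N𝔭^{-s})` and the conjugate imprimitive
`L`-function `L̄_𝔪(s) = conj L_𝔪(conj s) = L̄(s) Ē(s)` of the primitive data of a ray class character, with its Dirichlet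
series `−L̄_𝔪'/L̄_𝔪 = L(Λ^𝔪_{ψ̄}, ·)` on `Re s > 1` (`RayClassPrimitiveData.neg_logDeriv_LModConj_eq`).

## References
* J. Thorner, A. Zaman, Algebra Number Theory 11 (2017), Lemma 2.2, Lemma 7.3. [ThornerZaman2017]
* J. Neukirch, *Algebraic Number Theory*, Springer 1999, VII §8 (before (8.5)). [NeukirchANT1999]
-/

noncomputable section

open scoped NumberField ComplexConjugate
open Complex Filter Topology Set NumberField IsDedekindDomain Classical

namespace Literature.NumberTheory.LFunctions

open Literature.NumberTheory.LFunctions.NumberField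

variable {K : Type*} [Field K] [NumberField K]

/-! ### Summing a family supported on finitely many fibres -/

omit [NumberField K] in
/-- A family on `β × γ` supported on `T × γ` (`T` finite) whose fibres have sums `g b` has sum `Σ_{b ∈ T} g b`.
[folklore] -/
private theorem hasSum_prod_of_finset {β γ α : Type*} [AddCommMonoid α] [TopologicalSpace α] [ContinuousAdd α]
    (T : Finset β) {f : β × γ → α} {g : β → α} (hf : ∀ b ∈ T, HasSum (fun x ↦ f (b, x)) (g b))
    (h0 : ∀ q : β × γ, q.1 ∉ T → f q = 0) : HasSum f (∑ b ∈ T, g b) := by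
  -- `f = Σ_{b ∈ T} f_b`, `f_b` supported on the fibre of `b`
  set F : β → β × γ → α := fun b q ↦ if q.1 = b then f q else 0 with hF
  have hFb : ∀ b ∈ T, HasSum (F b) (g b) := by
    intro b hb
    have hinj : Function.Injective (fun x : γ ↦ (b, x)) := fun x y h ↦ by simpa using h
    have hzero : ∀ q : β × γ, q ∉ Set.range (fun x : γ ↦ (b, x)) → F b q = 0 := by
      intro q hq
      have : q.1 ≠ b := fun h ↦ hq ⟨q.2, by rw [← h]⟩
      simp [hF, this]
    refine (hinj.hasSum_iff hzero).mp ?_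
    refine (hf b hb).congr_fun fun x ↦ ?_
    simp [hF]
  have hsum := hasSum_sum (s := T) fun b hb ↦ hFb b hb
  refine hsum.congr_fun fun q ↦ ?_
  by_cases hq : q.1 ∈ T
  · rw [Finset.sum_eq_single_of_mem q.1 hq]
    · simp [hF]
    · intro b _ hb; simp [hF, Ne.symm hb]
  · rw [h0 q hq]
    refine (Finset.sum_eq_zero fun b hb ↦ ?_).symm
    have : q.1 ≠ b := fun h ↦ hq (h ▸ hb)
    simp only [hF, if_neg this]

/-! ### The Euler node family -/

variable (K) in
/-- The index type of the Euler nodes: (prime, integer). [cite: ThornerZaman2017, Lemma 7.3] -/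
abbrev EulerIdx : Type _ := HeightOneSpectrum (𝓞 K) × ℤ

/-- The node `ω_{𝔭,n} = i(arg c_𝔭 + 2πn)/log N𝔭`. [cite: ThornerZaman2017, Lemma 7.3] -/
def eulerFamilyNode (c : HeightOneSpectrum (𝓞 K) → ℂ) (i : EulerIdx K) : ℂ :=
  eulerNode (Ideal.absNorm i.1.asIdeal) (c i.1) i.2

/-- The weight `1_{𝔭 ∈ T}`. [cite: ThornerZaman2017, Lemma 7.3] -/
def eulerFamilyWt (T : Finset (HeightOneSpectrum (𝓞 K))) (i : EulerIdx K) : ℝ := if i.1 ∈ T then 1 else 0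

/-- The finite Euler product `E(s) = ∏_{𝔭 ∈ T}(1 − c_𝔭 N𝔭^{-s})`. [cite: NeukirchANT1999, Ch. VII §8 (8.5)] -/
def eulerProd (T : Finset (HeightOneSpectrum (𝓞 K))) (c : HeightOneSpectrum (𝓞 K) → ℂ) (s : ℂ) : ℂ :=
  ∏ v ∈ T, (1 - c v * ((Ideal.absNorm v.asIdeal : ℕ) : ℂ) ^ (-s))

section family

variable (T : Finset (HeightOneSpectrum (𝓞 K))) (c : HeightOneSpectrum (𝓞 K) → ℂ)

omit [NumberField K] in
/-- The weights are `0` or `1`. [cite: ThornerZaman2017, Lemma 7.3] -/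
theorem eulerFamilyWt_nonneg (i : EulerIdx K) : 0 ≤ eulerFamilyWt T i := by
  unfold eulerFamilyWt; split_ifs <;> norm_num

omit [NumberField K] in
/-- A positive weight is `1`. [cite: ThornerZaman2017, Lemma 7.3] -/
theorem one_le_eulerFamilyWt_of_pos {i : EulerIdx K} (h : 0 < eulerFamilyWt T i) : 1 ≤ eulerFamilyWt T i := by
  unfold eulerFamilyWt at h ⊢; split_ifs with hi
  · norm_num
  · simp [hi] at h

/-- The nodes are purely imaginary. [cite: ThornerZaman2017, Lemma 7.3] -/
theorem eulerFamilyNode_re (i : EulerIdx K) : (eulerFamilyNode c i).re = 0 := eulerNode_re _ _ _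

/-- `E` is entire. [cite: NeukirchANT1999, Ch. VII §8 (8.5)] -/
theorem differentiable_eulerProd : Differentiable ℂ (eulerProd T c) := by
  unfold eulerProd
  exact Differentiable.fun_finsetProd fun v _ ↦ differentiable_eulerFactor (c v) v

/-- `E(s) ≠ 0` for `Re s > 0` (unimodular coefficients). [cite: ThornerZaman2017, Lemma 7.3] -/
theorem eulerProd_ne_zero (hc : ∀ v ∈ T, ‖c v‖ = 1) {s : ℂ} (hs : 0 < s.re) : eulerProd T c s ≠ 0 := by
  unfold eulerProd
  exact Finset.prod_ne_zero_iff.mpr fun v hv ↦ eulerFactor_ne_zero (AbelianDensity.two_le_absNorm K v) (hc v hv) hs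

/-- `E'/E = Σ_{𝔭 ∈ T} h_𝔭'/h_𝔭` on `Re s > 0`. [cite: ThornerZaman2017, Lemma 7.2] -/
theorem logDeriv_eulerProd (hc : ∀ v ∈ T, ‖c v‖ = 1) {s : ℂ} (hs : 0 < s.re) :
    logDeriv (eulerProd T c) s =
      ∑ v ∈ T, logDeriv (fun z : ℂ ↦ 1 - c v * ((Ideal.absNorm v.asIdeal : ℕ) : ℂ) ^ (-z)) s := by
  have h := logDeriv_prod (s := T) (f := fun v (z : ℂ) ↦ 1 - c v * ((Ideal.absNorm v.asIdeal : ℕ) : ℂ) ^ (-z))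
    (x := s) (fun v hv ↦ eulerFactor_ne_zero (AbelianDensity.two_le_absNorm K v) (hc v hv) hs)
    (fun v _ ↦ (differentiable_eulerFactor (c v) v).differentiableAt)
  have heq : (fun z ↦ ∏ v ∈ T, (1 - c v * ((Ideal.absNorm v.asIdeal : ℕ) : ℂ) ^ (-z))) = eulerProd T c := by
    funext z; rfl
  rw [heq] at h
  exact h

/-- **The Euler node family sums to the higher logarithmic derivatives of `E`**: for unimodular `c` on `T`,
`Re s > 0` and `k ≥ 1`, `Σ_i w_i (s − ω_i)^{−(k+1)} = ((−1)^k/k!) (E'/E)^{(k)}(s)`. [cite: ThornerZaman2017, Lemma 2.2] -/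
theorem hasSum_eulerFamily (hc : ∀ v ∈ T, ‖c v‖ = 1) {s : ℂ} (hs : 0 < s.re) {k : ℕ} (hk : 1 ≤ k) :
    HasSum (fun i : EulerIdx K ↦ (eulerFamilyWt T i : ℂ) * ((s - eulerFamilyNode c i) ^ (k + 1))⁻¹)
      ((-1) ^ k / (k.factorial : ℂ) * iteratedDeriv k (logDeriv (eulerProd T c)) s) := by
  have hU : IsOpen {z : ℂ | 0 < z.re} := isOpen_lt continuous_const continuous_re
  -- fibrewise
  have hfib : ∀ v ∈ T, HasSum (fun n : ℤ ↦ (eulerFamilyWt T (v, n) : ℂ) * ((s - eulerFamilyNode c (v, n)) ^ (k + 1))⁻¹)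
      ((-1) ^ k / (k.factorial : ℂ) *
        iteratedDeriv k (logDeriv (fun z : ℂ ↦ 1 - c v * ((Ideal.absNorm v.asIdeal : ℕ) : ℂ) ^ (-z))) s) := by
    intro v hv
    have h := hasSum_iteratedDeriv_logDeriv_eulerFactor (AbelianDensity.two_le_absNorm K v) (hc v hv) hs hk
    refine h.congr_fun fun n ↦ ?_
    simp [eulerFamilyWt, hv, eulerFamilyNode]
  have h0 : ∀ q : EulerIdx K, q.1 ∉ T →
      (eulerFamilyWt T q : ℂ) * ((s - eulerFamilyNode c q) ^ (k + 1))⁻¹ = 0 := fun q hq ↦ by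
    simp [eulerFamilyWt, hq]
  have hsum := hasSum_prod_of_finset T hfib h0
  convert hsum using 1
  -- the logarithmic derivative of the product, differentiated
  have hev : logDeriv (eulerProd T c) =ᶠ[𝓝 s]
      fun z ↦ ∑ v ∈ T, logDeriv (fun w : ℂ ↦ 1 - c v * ((Ideal.absNorm v.asIdeal : ℕ) : ℂ) ^ (-w)) z := by
    filter_upwards [hU.mem_nhds hs] with z hz
    exact logDeriv_eulerProd T c hc hz
  have hcd : ∀ v ∈ T, ContDiffAt ℂ k (logDeriv (fun w : ℂ ↦ 1 - c v * ((Ideal.absNorm v.asIdeal : ℕ) : ℂ) ^ (-w))) s := by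
    intro v hv
    set h : ℂ → ℂ := fun w : ℂ ↦ 1 - c v * ((Ideal.absNorm v.asIdeal : ℕ) : ℂ) ^ (-w)
    have hd : Differentiable ℂ h := differentiable_eulerFactor (c v) v
    have hV : IsOpen {z : ℂ | 0 < z.re} := hU
    have hdiff : DifferentiableOn ℂ (logDeriv h) {z : ℂ | 0 < z.re} := by
      intro z hz
      have hz' : 0 < z.re := hz
      have hne : h z ≠ 0 := eulerFactor_ne_zero (AbelianDensity.two_le_absNorm K v) (hc v hv) hz'
      have ha : AnalyticAt ℂ h z := (hd.differentiableOn.analyticOnNhd isOpen_univ) z (Set.mem_univ _)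
      have : logDeriv h = fun w ↦ deriv h w / h w := by funext w; rw [logDeriv_apply]
      rw [this]
      exact (ha.deriv.differentiableAt.div ha.differentiableAt hne).differentiableWithinAt
    exact (hdiff.analyticAt (hV.mem_nhds hs)).contDiffAt
  rw [hev.iteratedDeriv_eq, iteratedDeriv_fun_sum hcd, Finset.mul_sum]

/-- **The sum over the Euler nodes**: `Σ_i w_i |s − ω_i|^{−2}` converges and is
`≤ Σ_{𝔭 ∈ T} (2/σ² + log N𝔭/σ)` for `σ = Re s > 0`. [cite: ThornerZaman2017, Lemma 7.3] -/
theorem tsum_eulerFamilyWt_mul_norm_le {s : ℂ} (hs : 0 < s.re) :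
    Summable (fun i : EulerIdx K ↦ eulerFamilyWt T i * ‖((s - eulerFamilyNode c i) ^ 2)⁻¹‖) ∧
      ∑' i : EulerIdx K, eulerFamilyWt T i * ‖((s - eulerFamilyNode c i) ^ 2)⁻¹‖ ≤
        ∑ v ∈ T, (2 / s.re ^ 2 + Real.log (Ideal.absNorm v.asIdeal : ℕ) / s.re) := by
  have hfib : ∀ v ∈ T, HasSum (fun n : ℤ ↦ eulerFamilyWt T (v, n) * ‖((s - eulerFamilyNode c (v, n)) ^ 2)⁻¹‖)
      (∑' n : ℤ, ‖((s - eulerNode (Ideal.absNorm v.asIdeal) (c v) n) ^ 2)⁻¹‖) := by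
    intro v hv
    have h := (tsum_norm_inv_sq_sub_eulerNode_le (AbelianDensity.two_le_absNorm K v) (c v) hs).1.hasSum
    refine h.congr_fun fun n ↦ ?_
    simp [eulerFamilyWt, hv, eulerFamilyNode]
  have h0 : ∀ q : EulerIdx K, q.1 ∉ T → eulerFamilyWt T q * ‖((s - eulerFamilyNode c q) ^ 2)⁻¹‖ = 0 :=
    fun q hq ↦ by simp [eulerFamilyWt, hq]
  have hsum := hasSum_prod_of_finset T hfib h0
  refine ⟨hsum.summable, ?_⟩
  rw [hsum.tsum_eq]
  exact Finset.sum_le_sum fun v hv ↦ (tsum_norm_inv_sq_sub_eulerNode_le (AbelianDensity.two_le_absNorm K v) (c v) hs).2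

/-- The bound simplified at `Re s = 2`: `Σ_{𝔭 ∈ T}(1/2 + log N𝔭/2) ≤ Σ_{𝔭 ∣ 𝔪} … ≤ log N𝔪` when `T` consists of prime
divisors of `𝔪 ≠ 0` (`N𝔭 ≥ 2`, `∏_{𝔭∣𝔪} N𝔭 ≤ N𝔪`; we use the cruder `1/2 ≤ log N𝔭` from `log 2 > 1/2`).
[cite: ThornerZaman2017, Lemma 7.3] -/
theorem sum_eulerBound_le_log_absNorm {𝔪 : Ideal (𝓞 K)} (h𝔪 : 𝔪 ≠ ⊥) (hT : ∀ v ∈ T, v.asIdeal ∣ 𝔪) :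
    ∑ v ∈ T, (2 / (2 : ℝ) ^ 2 + Real.log (Ideal.absNorm v.asIdeal : ℕ) / 2) ≤
      2 * Real.log (Ideal.absNorm 𝔪 : ℕ) := by
  -- `∏_{v ∈ T} N v ≤ N𝔪`
  have hinf : (T.inf fun v ↦ v.asIdeal) = ∏ v ∈ T, v.asIdeal := by
    have h := IsDedekindDomain.inf_pow_eq_prod_of_prime T (fun v : HeightOneSpectrum (𝓞 K) ↦ v.asIdeal)
      (fun _ ↦ 1) (fun v _ ↦ v.prime) (fun v _ w _ hvw h ↦ hvw (HeightOneSpectrum.ext h))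
    simpa only [pow_one] using h
  have hdvd : (∏ v ∈ T, v.asIdeal) ∣ 𝔪 := by
    rw [← hinf, Ideal.dvd_iff_le, Finset.le_inf_iff]
    exact fun v hv ↦ Ideal.le_of_dvd (hT v hv)
  have hN : Ideal.absNorm (∏ v ∈ T, v.asIdeal) ∣ Ideal.absNorm 𝔪 := map_dvd Ideal.absNorm hdvd
  have hm0 : Ideal.absNorm 𝔪 ≠ 0 := by rwa [Ne, Ideal.absNorm_eq_zero_iff]
  have hle : Ideal.absNorm (∏ v ∈ T, v.asIdeal) ≤ Ideal.absNorm 𝔪 := Nat.le_of_dvd (Nat.pos_of_ne_zero hm0) hN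
  rw [map_prod] at hle
  have hle' : ∏ v ∈ T, ((Ideal.absNorm v.asIdeal : ℕ) : ℝ) ≤ (Ideal.absNorm 𝔪 : ℕ) := by exact_mod_cast hle
  have hpos : ∀ v ∈ T, (0 : ℝ) < (Ideal.absNorm v.asIdeal : ℕ) := fun v _ ↦ by
    exact_mod_cast Nat.pos_of_ne_zero (by rw [Ne, Ideal.absNorm_eq_zero_iff]; exact v.ne_bot)
  have hlog : ∑ v ∈ T, Real.log (Ideal.absNorm v.asIdeal : ℕ) ≤ Real.log (Ideal.absNorm 𝔪 : ℕ) := by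
    rw [← Real.log_prod (fun v hv ↦ (hpos v hv).ne')]
    exact Real.log_le_log (Finset.prod_pos hpos) hle'
  -- each `log N v ≥ log 2 > 1/2`
  have hlog2 : ∀ v ∈ T, (1 : ℝ) / 2 ≤ Real.log (Ideal.absNorm v.asIdeal : ℕ) := fun v _ ↦ by
    have h2 : (2 : ℝ) ≤ (Ideal.absNorm v.asIdeal : ℕ) := by exact_mod_cast AbelianDensity.two_le_absNorm K v
    have := Real.log_two_gt_d9
    linarith [Real.log_le_log (by norm_num) h2]
  calc ∑ v ∈ T, (2 / (2 : ℝ) ^ 2 + Real.log (Ideal.absNorm v.asIdeal : ℕ) / 2)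
      ≤ ∑ v ∈ T, (Real.log (Ideal.absNorm v.asIdeal : ℕ) + Real.log (Ideal.absNorm v.asIdeal : ℕ)) :=
        Finset.sum_le_sum fun v hv ↦ by have := hlog2 v hv; norm_num at this ⊢; linarith
    _ = 2 * ∑ v ∈ T, Real.log (Ideal.absNorm v.asIdeal : ℕ) := by rw [two_mul, Finset.sum_add_distrib]
    _ ≤ 2 * Real.log (Ideal.absNorm 𝔪 : ℕ) := by linarith

end family

/-! ### The conjugate imprimitive `L`-function of the primitive data -/

namespace RayClassPrimitiveData

variable {𝔪 : Ideal (𝓞 K)} {ψ : HeightOneSpectrum (𝓞 K) → ℂ} (D : RayClassPrimitiveData 𝔪 ψ)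

/-- `|χ₀(𝔭)| = 1` at the bad primes (`𝔭 ∤ 𝔣`). [cite: NeukirchANT1999, Ch. VII §8 (8.5)] -/
theorem norm_eq_one_of_mem_badPrimes {v : HeightOneSpectrum (𝓞 K)} (hv : v ∈ D.badPrimes) : ‖D.χ₀ v‖ = 1 := by
  rw [badPrimes, Finset.mem_filter] at hv
  exact D.isRayClassCharacter.norm_eq_one v hv.2

/-- `|conj χ₀(𝔭)| = 1` at the bad primes. [cite: NeukirchANT1999, Ch. VII §8 (8.5)] -/
theorem norm_conj_eq_one_of_mem_badPrimes {v : HeightOneSpectrum (𝓞 K)} (hv : v ∈ D.badPrimes) :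
    ‖(star D.χ₀) v‖ = 1 := by
  rw [Pi.star_apply, Complex.star_def, Complex.norm_conj]; exact D.norm_eq_one_of_mem_badPrimes hv

/-- The Euler correction as an `eulerProd`. [cite: NeukirchANT1999, Ch. VII §8 (8.5)] -/
theorem eulerCorr_eq_eulerProd : D.eulerCorr = eulerProd D.badPrimes D.χ₀ := by
  funext s; rfl

/-- The conjugate Euler correction `Ē(s) = ∏_{𝔭 ∈ bad}(1 − χ̄₀(𝔭) N𝔭^{-s})`. [cite: NeukirchANT1999, Ch. VII §8 (8.5)] -/
def eulerCorrConj (s : ℂ) : ℂ := eulerProd D.badPrimes (star D.χ₀) s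

/-- The conjugate imprimitive `L`-function `L̄_𝔪(s) = L̄(s) Ē(s)`. [cite: NeukirchANT1999, Ch. VII §8 Thm. (8.5)] -/
def LModConj (s : ℂ) : ℂ := D.Lconj s * D.eulerCorrConj s

/-- `Ē(s) = conj E(conj s)`. [cite: ThornerZaman2017, Lemma 7.3] -/
theorem eulerCorrConj_eq (s : ℂ) : D.eulerCorrConj s = conj (D.eulerCorr (conj s)) := by
  rw [eulerCorrConj, eulerProd, eulerCorr, map_prod]
  refine Finset.prod_congr rfl fun v _ ↦ ?_
  rw [map_sub, map_one, map_mul, conj_natCast_cpow, map_neg, Complex.conj_conj, Pi.star_apply, Complex.star_def]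

/-- `L̄_𝔪(s) = conj L_𝔪(conj s)`. [cite: ThornerZaman2017, Lemma 7.3] -/
theorem LModConj_eq (s : ℂ) : D.LModConj s = conj (D.LMod (conj s)) := by
  rw [LModConj, LMod, map_mul, Lconj, eulerCorrConj_eq]

/-- `L̄_𝔪(s) = L_𝔪(s, ψ̄)` for `Re s > 1`. [cite: NeukirchANT1999, Ch. VII §8 (8.1)] -/
theorem LModConj_eq_rayClassLSeries {s : ℂ} (hs : 1 < s.re) :
    D.LModConj s = rayClassLSeries 𝔪 (fun v ↦ conj (ψ v)) s := by
  have hs' : 1 < (conj s).re := by rwa [conj_re]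
  have hψ1 : ∀ v : HeightOneSpectrum (𝓞 K), ¬ 𝔪 ≤ v.asIdeal → ‖ψ v‖ ≤ 1 := fun v hv ↦ by
    rw [← D.agree v hv]; exact D.norm_le_one v (fun h ↦ hv (D.le.trans h))
  rw [D.LModConj_eq, D.LMod_eq hs', rayClassLSeries_conj D.modulus_ne_bot hψ1 hs]

/-- **`−L̄_𝔪'/L̄_𝔪 = L(Λ^𝔪_{ψ̄}, ·)`** on `Re s > 1`. [cite: LagariasOdlyzko1977, §5 (5.2)] -/
theorem neg_logDeriv_LModConj_eq {s : ℂ} (hs : 1 < s.re) :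
    -(deriv D.LModConj s / D.LModConj s) =
      LSeries (twistVonMangoldt K (rayClassCoeffHom 𝔪 (fun v ↦ conj (ψ v)))) s := by
  have hψ1 : ∀ v : HeightOneSpectrum (𝓞 K), ¬ 𝔪 ≤ v.asIdeal → ‖conj (ψ v)‖ ≤ 1 := fun v hv ↦ by
    rw [Complex.norm_conj, ← D.agree v hv]; exact D.norm_le_one v (fun h ↦ hv (D.le.trans h))
  exact neg_logDeriv_continuation_eq_LSeries D.modulus_ne_bot hψ1 (fun z hz ↦ D.LModConj_eq_rayClassLSeries hz) hs

/-- **`−L_𝔪'/L_𝔪 = L(Λ^𝔪_ψ, ·)`** on `Re s > 1` (restated with `deriv / value`). [cite: LagariasOdlyzko1977, §5 (5.2)] -/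
theorem neg_logDeriv_LMod_eq' {s : ℂ} (hs : 1 < s.re) :
    -(deriv D.LMod s / D.LMod s) = LSeries (twistVonMangoldt K (rayClassCoeffHom 𝔪 ψ)) s := by
  have hψ1 : ∀ v : HeightOneSpectrum (𝓞 K), ¬ 𝔪 ≤ v.asIdeal → ‖ψ v‖ ≤ 1 := fun v hv ↦ by
    rw [← D.agree v hv]; exact D.norm_le_one v (fun h ↦ hv (D.le.trans h))
  exact neg_logDeriv_continuation_eq_LSeries D.modulus_ne_bot hψ1 (fun z hz ↦ D.LMod_eq hz) hs

end RayClassPrimitiveData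

end Literature.NumberTheory.LFunctions

end
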